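import Summits.SmoothPoincare4.SmoothPoincare4.Theorems.ConvexBisectionAcyclicBisectionExistsComplementPieceExists
import Summits.SmoothPoincare4.SmoothPoincare4.Theorems.ConvexBisectionAcyclicBisectionExistsDualHandlePlumbing
import HarnessLib

/-!
# Dual handles, T3b (v): the seam clause of the dual presentation and the concrete complement piece
(sub-goal T3b (v) of stub `stub_T3_dualPresentation` (T3), line `modp-braid-orbits` r12, crux
`ConvexBisection.AcyclicBisectionExists`, item stmt-SmoothPoincare4-10508; wave 5, lead c5, worker X2;
registered sub-goal `helper_dualMap_apply_ne_incl`)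

The assembly brick of the dual presentation `M = X₁ ∪_φ W₂`, `W₂ = W ∪_{dual maps} (handles)`
(Milnor 1965 §3; Kosinski 1993 VI §8, VII §1; Gompf–Stipsicz 1999 §8.2).  The four LANDED bricks
(V5 compatible split `exists_compatible_split`, V5 standard form `exists_standardForm`, Y5 pushed prefix
embedding `exists_pushedPrefixEmbedding`, Y6 complement piece `exists_complementPiece`) are composed in
the assembly file; here are the three missing pieces of glue, all PROVED:

* §1 `dualMap_apply_ne_incl` (registered as `helper_dualMap_apply_ne_incl`): a value of a dual
  attaching map is never an old-seam point `bW.incl (Ψ z)` lying over a base point off the range of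
  the corresponding attaching map (the dual tube meets `∂W` exactly in `Ψ` of the belt tube, whose
  glued points lie over the attaching tube; Kosinski's gluing relation);
* §2 `exists_complementPiece_concrete`: Y6's complement piece with the CONCRETE carrier
  `RegularSublevel hΦ` of the level function (Y6 exported an abstract `W₂`; brick (iv) — the dual
  multi-attachment data, worker X1 — is built on the concrete regular sublevel set, so the assembler
  needs the gluing `φ` and the export clauses for that very type);
* §3 `seam_clause_of_exports`: THE SEAM CLAUSE of the node `node_dual_presentation` — over a base
  point `a` off the prefix cores and off the suffix ranges, the new seam is the dual embedding of the
  old one: `b₂.incl (φ y) = D₂.jA ⟨bW.incl (Ψ z), _⟩` — from Y6's seam identity, Y5's clause (a),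
  V5's compatibility `D₂'.jA ∘ D₁.jA = D.jA`, Milnor's `j_M (bX.incl z) = j_N (bW.incl (Ψ z))` and the
  export clause (E1) "`E = j_N` off the dual ranges" of the dual data (taken as a hypothesis on an
  arbitrary `D₂`).

Everything here is proved; no named facts, no `sorry`.

## References
* J. Milnor, *Lectures on the h-cobordism theorem* (1965), §3. [MilnorHCobordism1965]
* A. Kosinski, *Differential Manifolds* (1993), VI §6, §8. [Kosinski1993]
* J. Milnor, *Morse theory* (1963), Thm. 3.1. [Milnor1963]
-/

noncomputable section

-- the prescribed namespace `Summit.<P>.<Sub>.…` duplicates `SmoothPoincare4` (P = Sub)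
set_option linter.dupNamespace false

open scoped Manifold ContDiff Topology

namespace Summit.SmoothPoincare4.SmoothPoincare4.Theorems.AcyclicBisectionExists.ModpBraidOrbits

open Set Function Metric Filter Topology
open Literature.Topology.FourManifolds Literature.Topology.FourManifolds.HandleAttachingMap

/-! ### §1 Dual attaching maps never hit the old seam over off-range base points -/

section DualRange

variable {B : Type} [TopologicalSpace B] [T2Space B] [ChartedSpace (EuclideanHalfSpace 4) B]
  {ι : Type} [Finite ι] {h : ι → HandleAttachingMap 3 2 B}
  {X : Type} [TopologicalSpace X] [ChartedSpace (EuclideanHalfSpace 4) X] [IsManifold (𝓡∂ 4) ∞ X]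
  {W : Type} [TopologicalSpace W] [ChartedSpace (EuclideanHalfSpace 4) W] [IsManifold (𝓡∂ 4) ∞ W]

/-- **A dual attaching map never takes the value `bW.incl (Ψ z)` over a base point off the range of
the attaching map.**  If `(dualMap … j) y = bW.incl (Ψ z)` then the value is a boundary point, so `y`
lies on the sphere `T ∩ ∂D⁴`, where the dual map is the seam push of the belt tube: `Ψ z' ` with
`bX.incl z' = beltMap D j (depthLine θ v 0) = D.jB j (…)`; hence `z' = z`, `D.jA a = D.jB j (…)`, and
Kosinski's gluing relation puts `a` in the range of `h j`. [cite: Kosinski1993, VI §6] -/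
theorem dualMap_apply_ne_incl (D : MultiAttachmentData h (𝓡∂ 4) X) (bX : BoundaryData (𝓡∂ 4) X (𝓡 3))
    (bW : BoundaryData (𝓡∂ 4) W (𝓡 3)) (Ψ : bX.carrier ≃ₘ⟮𝓡 3, 𝓡 3⟯ bW.carrier)
    (col : (BoundaryManifold.boundaryData 3 W).Collar) (κ δ : ℝ) (hκ : 0 < κ) (hκ1 : κ ≤ 1) (hδ : 0 < δ)
    (hδ2 : δ ≤ 1 / 2) (j : ι) (y : ↥(handleTube 3 2)) (z : bX.carrier) (a : ↥(coresComplement h))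
    (hz : D.jA a = bX.incl z) (ha : (a : B) ∉ range (h j).toFun) :
    (dualMap D bX bW Ψ col κ δ hκ hκ1 hδ hδ2 j).toFun y ≠ bW.incl (Ψ z) := by
  intro heq
  let A := pushedTubeData (beltMap D j) (seamDiffeo bX bW Ψ) col κ δ hκ hκ1 hδ hδ2
  have hfun : (dualMap D bX bW Ψ col κ δ hκ hκ1 hδ hδ2 j).toFun = A.map := rfl
  -- the value is a boundary point, so `y` lies on the sphere
  have hbd : (dualMap D bX bW Ψ col κ δ hκ hκ1 hδ hδ2 j).toFun y ∈ (𝓡∂ 4).boundary W := by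
    rw [heq]; exact bW.incl_mem_boundary _
  have hy1 : ‖tubeVec y‖ = 1 := ((dualMap D bX bW Ψ col κ δ hκ hκ1 hδ hδ2 j).apply_mem_boundary_iff y).1 hbd
  rw [hfun, A.map_of_norm_eq_one hy1] at heq
  -- there the dual map is the seam push of the belt tube point `p₁`
  have hlift : A.liftFst y =
      seamDiffeo bX bW Ψ ((beltMap D j).boundaryTube.toHomeo (tubeAngle y, κ • tubeFibre y)) := by
    show ((beltMap D j).boundaryTube.mapDiffeo (seamDiffeo bX bW Ψ)).toHomeo (tubeAngle y, κ • tubeFibre y) = _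
    rw [CircleTube.mapDiffeo_apply]; rfl
  rw [hlift, coe_seamDiffeo] at heq
  -- so `Ψ (R p₁) = Ψ z`, `R p₁ = z`, and `p₁ = bX.incl z = D.jA a` as points of `X`
  have hRz := Ψ.injective (bW.injective_incl heq)
  have hpX : bX.incl z =
      (((beltMap D j).boundaryTube.toHomeo (tubeAngle y, κ • tubeFibre y) : ↥((𝓡∂ 4).boundary X)) : X) := by
    rw [← hRz, incl_restrict_refl]; rfl
  have hpB : (((beltMap D j).boundaryTube.toHomeo (tubeAngle y, κ • tubeFibre y) : ↥((𝓡∂ 4).boundary X)) : X) =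
      D.jB j (swapTube (depthLine (tubeAngle y) (κ • tubeFibre y) 0)) :=
    (beltMap D j).coe_boundaryTube_apply _ _
  -- Kosinski's gluing relation puts `a` in the range of `h j`
  obtain ⟨y', -, -, hy'⟩ := (D.glue j a _).1 ((hz.trans hpX).trans hpB)
  exact ha ⟨y', hy'.symm⟩

/-- **Corollary (the form used by the seam clause)**: over a base point off the ranges of a whole
sub-family of attaching maps, the old-seam point is off all the corresponding dual ranges.
[cite: Kosinski1993, VI §6] -/
theorem forall_dualMap_apply_ne_incl (D : MultiAttachmentData h (𝓡∂ 4) X) (bX : BoundaryData (𝓡∂ 4) X (𝓡 3))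
    (bW : BoundaryData (𝓡∂ 4) W (𝓡 3)) (Ψ : bX.carrier ≃ₘ⟮𝓡 3, 𝓡 3⟯ bW.carrier)
    (col : (BoundaryManifold.boundaryData 3 W).Collar) (κ δ : ℝ) (hκ : 0 < κ) (hκ1 : κ ≤ 1) (hδ : 0 < δ)
    (hδ2 : δ ≤ 1 / 2) {ι' : Type} (f : ι' → ι) (z : bX.carrier) (a : ↥(coresComplement h))
    (hz : D.jA a = bX.incl z) (ha : (a : B) ∉ ⋃ j, range (h (f j)).toFun) :
    ∀ (j : ι') (y : ↥(handleTube 3 2)), (dualMap D bX bW Ψ col κ δ hκ hκ1 hδ hδ2 (f j)).toFun y ≠ bW.incl (Ψ z) :=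
  fun j y => dualMap_apply_ne_incl D bX bW Ψ col κ δ hκ hκ1 hδ hδ2 (f j) y z a hz
    fun hj => ha (mem_iUnion.2 ⟨j, hj⟩)

end DualRange

/-! ### §2 Y6's complement piece on the CONCRETE regular sublevel set -/

section Concrete

variable {B : Type} [TopologicalSpace B] [T2Space B] [ChartedSpace (EuclideanHalfSpace 4) B]
  {ι : Type} [Finite ι] {h : ι → HandleAttachingMap 3 2 B}
  {X : Type} [TopologicalSpace X] [ChartedSpace (EuclideanHalfSpace 4) X] [IsManifold (𝓡∂ 4) ∞ X]
  (D : MultiAttachmentData h (𝓡∂ 4) X) {ι' : Type} [Finite ι'] (f : ι' → ι)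
  {bX : BoundaryData (𝓡∂ 4) X (𝓡 3)}
  {W : Type} [TopologicalSpace W] [ChartedSpace (EuclideanHalfSpace 4) W]
  [IsManifold (𝓡∂ 4) ∞ W] {bW : BoundaryData (𝓡∂ 4) W (𝓡 3)} [Nonempty bX.carrier]
  (G : BoundaryGlueData bX bW) {a κ δ : ℝ} [CompactSpace X] [T2Space X] [T2Space W] [CompactSpace W]
  {X₁ : Type} [TopologicalSpace X₁] [CompactSpace X₁] [ChartedSpace (EuclideanHalfSpace 4) X₁]
  [IsManifold (𝓡∂ 4) ∞ X₁] {jX₁ : X₁ → G.d₂.Glued}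

omit [Finite ι'] [CompactSpace X] [CompactSpace W] in
/-- **Y6's complement piece `W₂ = {Φ ≤ 0}` with the concrete carrier `RegularSublevel hΦ`** (the same
proof as `exists_complementPiece`, whose statement hides the carrier behind an `∃`): the gluing
`φ : ∂X₁ ≅ ∂{Φ ≤ 0}` in Milnor's `M' = G.d₂.Glued` witnessed by `jX₁` and the inclusion, the seam
identity, the cover, the gluing relation, `W ⊆ W₂`, and the two membership tests.  `hΦ` is any proof
that `0` is a regular level (e.g. `isRegularLevel_levelFn …`). [cite: Milnor1963, Thm. 3.1] -/
theorem exists_complementPiece_concrete (ha : 0 < a) (hf : Injective f) (hCM : ∀ j, CollarAdapted D (f j) G a)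
    (hκ : 0 < κ) (hκ2 : κ ≤ 1 / 2) (hδ : 0 < δ) (hδ2 : δ ≤ 1 / 2)
    (hΦ : IsRegularLevel (𝓡 4) (levelFn D f G a κ δ) 0)
    (hemb : Manifold.IsSmoothEmbedding (𝓡∂ 4) (𝓡 4) ∞ jX₁)
    (H1 : range jX₁ ⊆ range G.jM)
    (H2 : ∀ y : X, (∀ (j : ι') (b : ↥(beltPiece 3 2)), D.jB (f j) b ≠ y) → G.jM y ∈ range jX₁)
    (H3 : ∀ (j : ι') (b : ↥(beltPiece 3 2)), G.jM (D.jB (f j) b) ∈ range jX₁ ↔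
      0 < ‖lamPart ((b : closedBall (0 : EuclideanSpace ℝ (Fin 4)) 1) : EuclideanSpace ℝ (Fin 4))‖ ^ 2 ∧
        0 ≤ modelH κ δ ((b : closedBall (0 : EuclideanSpace ℝ (Fin 4)) 1) : EuclideanSpace ℝ (Fin 4))) :
    ∃ φ : (BoundaryManifold.boundaryData 3 X₁).carrier ≃ₘ⟮𝓡 3, 𝓡 3⟯ (RegularSublevel.boundaryData hΦ).carrier,
      IsBoundaryGluing (BoundaryManifold.boundaryData 3 X₁) (RegularSublevel.boundaryData hΦ) φ (𝓡 4) G.d₂.Glued ∧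
      (∀ z, RegularSublevel.incl hΦ ((RegularSublevel.boundaryData hΦ).incl (φ z)) =
        jX₁ ((BoundaryManifold.boundaryData 3 X₁).incl z)) ∧
      range jX₁ ∪ range (RegularSublevel.incl hΦ) = univ ∧
      (∀ (q : X₁) (w : RegularSublevel hΦ), jX₁ q = RegularSublevel.incl hΦ w ↔
        ∃ z, q = (BoundaryManifold.boundaryData 3 X₁).incl z ∧ w = (RegularSublevel.boundaryData hΦ).incl (φ z)) ∧
      range G.jN ⊆ range (RegularSublevel.incl hΦ) ∧
      (∀ (j : ι') (b : ↥(beltPiece 3 2)), G.jM (D.jB (f j) b) ∈ range (RegularSublevel.incl hΦ) ↔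
        modelH κ δ ((b : closedBall (0 : EuclideanSpace ℝ (Fin 4)) 1) : EuclideanSpace ℝ (Fin 4)) ≤ 0 ∨
          ‖((b : closedBall (0 : EuclideanSpace ℝ (Fin 4)) 1) : EuclideanSpace ℝ (Fin 4))‖ = 1) ∧
      (∀ y : X, (∀ (j : ι') (b : ↥(beltPiece 3 2)), D.jB (f j) b ≠ y) →
        (G.jM y ∈ range (RegularSublevel.incl hΦ) ↔ ∃ z, bX.incl z = y)) := by
  have hsub := levelFn_nonneg_iff_mem_range D f G ha hf hCM hκ hκ2 hδ hδ2 H1 H2 H3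
  obtain ⟨φ, hglue, hseam, hcover, hrel⟩ := exists_gluing hΦ hemb hsub
  have hrange : ∀ p, p ∈ range (RegularSublevel.incl hΦ) ↔ levelFn D f G a κ δ p ≤ 0 := fun p => by
    rw [RegularSublevel.range_incl]; rfl
  refine ⟨φ, hglue, hseam, hcover, hrel, ?_, fun j b => ?_, fun y hy => ?_⟩
  · rintro _ ⟨c, rfl⟩
    exact (hrange _).2 (levelFn_jN_nonpos D f G ha hf hCM hκ hκ2 hδ hδ2 c)
  · rw [hrange, levelFn_jM_jB_nonpos_iff D f G ha hf hCM hκ hκ2 hδ hδ2]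
  · rw [hrange, levelFn_jM_of_forall_ne D f G ha hCM hκ hκ2 hy, ← collarHeightFn_eq_zero_iff']
    exact ⟨fun h' => le_antisymm h' (collarHeightFn_nonneg' _ y), fun h' => h'.le⟩

end Concrete

/-! ### §3 The seam clause of the dual presentation -/

section Seam

variable {B : Type} [TopologicalSpace B] [T2Space B] [ChartedSpace (EuclideanHalfSpace 4) B]
  [IsManifold (𝓡∂ 4) ∞ B]
  {ι : Type} [Finite ι] {h : ι → HandleAttachingMap 3 2 B}
  {X : Type} [TopologicalSpace X] [ChartedSpace (EuclideanHalfSpace 4) X] [IsManifold (𝓡∂ 4) ∞ X]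
  {W : Type} [TopologicalSpace W] [T2Space W] [ChartedSpace (EuclideanHalfSpace 4) W] [IsManifold (𝓡∂ 4) ∞ W]

/-- The suffix index map `j ↦ m + j` of a split `k = m + n` is injective (bookkeeping). [folklore] -/
theorem suffix_injective {m n k : ℕ} (hk : k = m + n) :
    Injective fun j : Fin n => Fin.cast hk.symm (Fin.natAdd m j) := fun j j' e => by
  have := congrArg Fin.val e
  simp at this
  exact Fin.ext this

/-- **Over a base point off the suffix ranges, the prefix point `D₁.jA a` has no suffix-tube
preimage at all** (the lifted suffix map is `D₁.jA ∘ h̄ⱼ` and `D₁.jA` is injective), so every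
"for all tube preimages" side condition holds vacuously there. [folklore] -/
theorem forall_lift_apply_ne {ι₁ ι' : Type} [Finite ι₁] {p : ι₁ → HandleAttachingMap 3 2 B}
    {X₁ : Type} [TopologicalSpace X₁] [T2Space X₁] [ChartedSpace (EuclideanHalfSpace 4) X₁]
    [IsManifold (𝓡∂ 4) ∞ X₁]
    (D₁ : MultiAttachmentData p (𝓡∂ 4) X₁) (q : ι' → HandleAttachingMap 3 2 B)
    (hq : ∀ j i, Disjoint (range (q j).toFun) (range (p i).toFun))
    (a : ↥(coresComplement p)) (ha : (a : B) ∉ ⋃ j, range (q j).toFun)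
    (j : ι') (t : ↥(handleTube 3 2)) : (D₁.lift (q j) (hq j)).toFun t ≠ D₁.jA a := by
  intro he
  rw [MultiAttachmentData.lift_apply] at he
  have ht : (q j).toFun t = (a : B) := congrArg Subtype.val (D₁.injective_jA he)
  exact ha (mem_iUnion.2 ⟨j, t, ht⟩)

/-- **The prefix point over a base point off the suffix ranges is off the lifted suffix cores.**
[folklore] -/
theorem jA_mem_coresComplement_lift {ι₁ ι' : Type} [Finite ι₁] [Finite ι'] {p : ι₁ → HandleAttachingMap 3 2 B}
    {X₁ : Type} [TopologicalSpace X₁] [T2Space X₁] [ChartedSpace (EuclideanHalfSpace 4) X₁]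
    [IsManifold (𝓡∂ 4) ∞ X₁]
    (D₁ : MultiAttachmentData p (𝓡∂ 4) X₁) (q : ι' → HandleAttachingMap 3 2 B)
    (hq : ∀ j i, Disjoint (range (q j).toFun) (range (p i).toFun))
    (a : ↥(coresComplement p)) (ha : (a : B) ∉ ⋃ j, range (q j).toFun) :
    D₁.jA a ∈ coresComplement fun j => D₁.lift (q j) (hq j) := by
  rw [mem_coresComplement]
  intro j hj
  obtain ⟨t, -, ht⟩ := (MultiAttachmentData.mem_core_lift_iff D₁ (q j) (hq j)).1 hj
  exact forall_lift_apply_ne D₁ q hq a ha j t (by rw [MultiAttachmentData.lift_apply]; exact ht)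

/-- **THE SEAM CLAUSE of the dual presentation** (conjunct 3 of `node_dual_presentation`).
Setting: `X = B ∪ (prefix ∪ suffix handles)` with data `D`, the compatible split `X₁ = B ∪ (prefix)`
(data `D₁`) with suffix data `D₂'` on `X` satisfying `D₂'.jA (D₁.jA a) = D.jA a` (V5), Milnor's
gluing `G` of `X` and `W` along `G.φ`, ANY map `jX₁ : X₁ → M'` with Y5's clause (a)
(`jX₁ p = j_M (D₂'.jA p)` at points without deep suffix-tube preimages), ANY injective
`jW₂ : W₂ → M'` with Y6's seam identity `jW₂ (b₂.incl (φ z)) = jX₁ (∂X₁.incl z)`, and ANY dual data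
`D₂` on `W₂` with the export clause (E1) "`jW₂ ∘ D₂.jA = j_N` off the dual ranges".  Then over every
base point `a` off the prefix cores and off the suffix RANGES, with `D.jA a = bX.incl z` and
`∂X₁.incl y = D₁.jA a`, the new seam is the dual embedding of the old one:
`b₂.incl (φ y) = D₂.jA ⟨bW.incl (G.φ z), _⟩`.  Chain: `jW₂ (b₂.incl (φ y)) = jX₁ (D₁.jA a) =
j_M (D₂'.jA (D₁.jA a)) = j_M (D.jA a) = j_M (bX.incl z) = j_N (bW.incl (G.φ z)) = jW₂ (D₂.jA _)`
(§1 for the last step), and `jW₂` is injective. [cite: MilnorHCobordism1965, §3] -/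
theorem seam_clause_of_exports (m n : ℕ) {k : ℕ} (hk : k = m + n) {h : Fin k → HandleAttachingMap 3 2 B}
    (D : MultiAttachmentData h (𝓡∂ 4) X)
    {X₁ : Type} [TopologicalSpace X₁] [T2Space X₁] [ChartedSpace (EuclideanHalfSpace 4) X₁]
    [IsManifold (𝓡∂ 4) ∞ X₁]
    (D₁ : MultiAttachmentData (fun i : Fin m => h (Fin.cast hk.symm (Fin.castAdd n i))) (𝓡∂ 4) X₁)
    (D₂' : MultiAttachmentData
      (fun j : Fin n => D₁.lift (h (Fin.cast hk.symm (Fin.natAdd m j))) (disjoint_range_natAdd_castAdd hk D j))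
      (𝓡∂ 4) X)
    (hA : ∀ (a : ↥(coresComplement h))
      (ha₁ : (a : B) ∈ coresComplement fun i : Fin m => h (Fin.cast hk.symm (Fin.castAdd n i)))
      (ha₂ : D₁.jA ⟨a, ha₁⟩ ∈ coresComplement fun j : Fin n =>
        D₁.lift (h (Fin.cast hk.symm (Fin.natAdd m j))) (disjoint_range_natAdd_castAdd hk D j)),
      D₂'.jA ⟨D₁.jA ⟨a, ha₁⟩, ha₂⟩ = D.jA a)
    {bX : BoundaryData (𝓡∂ 4) X (𝓡 3)} {bW : BoundaryData (𝓡∂ 4) W (𝓡 3)} [Nonempty bX.carrier]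
    (G : BoundaryGlueData bX bW) (col : (BoundaryManifold.boundaryData 3 W).Collar)
    (κ δ : ℝ) (hκ : 0 < κ) (hκ1 : κ ≤ 1) (hδ : 0 < δ) (hδ2 : δ ≤ 1 / 2) (c : ℝ)
    (jX₁ : X₁ → G.d₂.Glued)
    (hYa : ∀ (p : X₁) (hp : p ∈ coresComplement fun j : Fin n =>
        D₁.lift (h (Fin.cast hk.symm (Fin.natAdd m j))) (disjoint_range_natAdd_castAdd hk D j)),
      (∀ (j : Fin n) (t : ↥(handleTube 3 2)),
        (D₁.lift (h (Fin.cast hk.symm (Fin.natAdd m j))) (disjoint_range_natAdd_castAdd hk D j)).toFun t = p →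
        ‖lamPart (t : EuclideanSpace ℝ (Fin 4))‖ ^ 2 ≤ c) →
      jX₁ p = G.jM (D₂'.jA ⟨p, hp⟩))
    {W₂ : Type} [TopologicalSpace W₂] [ChartedSpace (EuclideanHalfSpace 4) W₂]
    (b₂ : BoundaryData (𝓡∂ 4) W₂ (𝓡 3)) (jW₂ : W₂ → G.d₂.Glued) (hinj : Injective jW₂)
    (φ : (BoundaryManifold.boundaryData 3 X₁).carrier ≃ₘ⟮𝓡 3, 𝓡 3⟯ b₂.carrier)
    (hseamId : ∀ z, jW₂ (b₂.incl (φ z)) = jX₁ ((BoundaryManifold.boundaryData 3 X₁).incl z))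
    (D₂ : MultiAttachmentData
      (fun j : Fin n => dualMap D bX bW G.φ col κ δ hκ hκ1 hδ hδ2 (Fin.cast hk.symm (Fin.natAdd m j))) (𝓡∂ 4) W₂)
    (hE1 : ∀ (w : W) (hw : w ∈ coresComplement
        fun j : Fin n => dualMap D bX bW G.φ col κ δ hκ hκ1 hδ hδ2 (Fin.cast hk.symm (Fin.natAdd m j))),
      (∀ (j : Fin n) (y : ↥(handleTube 3 2)),
        (dualMap D bX bW G.φ col κ δ hκ hκ1 hδ hδ2 (Fin.cast hk.symm (Fin.natAdd m j))).toFun y ≠ w) →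
      jW₂ (D₂.jA ⟨w, hw⟩) = G.jN w)
    (y : (BoundaryManifold.boundaryData 3 X₁).carrier) (a : ↥(coresComplement h))
    (ha₁ : (a : B) ∈ coresComplement fun i : Fin m => h (Fin.cast hk.symm (Fin.castAdd n i)))
    (z : bX.carrier) (hz : D.jA a = bX.incl z)
    (hy : (BoundaryManifold.boundaryData 3 X₁).incl y = D₁.jA ⟨a, ha₁⟩)
    (hoff : (a : B) ∉ ⋃ j : Fin n, range (h (Fin.cast hk.symm (Fin.natAdd m j))).toFun) :
    b₂.incl (φ y) = D₂.jA ⟨bW.incl (G.φ z), incl_mem_coresComplement_dualMap D bX bW G.φ col κ δ hκ hκ1 hδ hδ2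
      (fun j : Fin n => Fin.cast hk.symm (Fin.natAdd m j)) z a hz⟩ := by
  apply hinj
  have ha₂ := jA_mem_coresComplement_lift D₁ (fun j : Fin n => h (Fin.cast hk.symm (Fin.natAdd m j)))
    (disjoint_range_natAdd_castAdd hk D) ⟨(a : B), ha₁⟩ hoff
  have hvac : ∀ (j : Fin n) (t : ↥(handleTube 3 2)),
      (D₁.lift (h (Fin.cast hk.symm (Fin.natAdd m j))) (disjoint_range_natAdd_castAdd hk D j)).toFun t =
        D₁.jA ⟨a, ha₁⟩ → ‖lamPart (t : EuclideanSpace ℝ (Fin 4))‖ ^ 2 ≤ c := fun j t ht =>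
    absurd ht (forall_lift_apply_ne D₁ (fun j : Fin n => h (Fin.cast hk.symm (Fin.natAdd m j)))
      (disjoint_range_natAdd_castAdd hk D) ⟨(a : B), ha₁⟩ hoff j t)
  have hoffW := forall_dualMap_apply_ne_incl D bX bW G.φ col κ δ hκ hκ1 hδ hδ2
    (fun j : Fin n => Fin.cast hk.symm (Fin.natAdd m j)) z a hz hoff
  rw [hseamId, hy, hYa _ ha₂ hvac, hA a ha₁ ha₂, hz, G.jM_incl, hE1 _ _ hoffW, G.jN_incl,
    Diffeomorph.symm_apply_apply]

end Seam

/-! ### §4 Registered helper -/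

/-- **Sub-goal `helper_dualMap_apply_ne_incl` of stub `stub_T3_dualPresentation`** (T3 ▸ T3b (v);
wave 5, lead c5): a dual attaching map never takes an old-seam value `bW.incl (Ψ z)` over a base
point off the range of the corresponding attaching map (`dualMap_apply_ne_incl`, fully qualified
registered text). [cite: Kosinski1993, VI §6] -/
theorem helper_dualMap_apply_ne_incl : ∀ {B : Type} [TopologicalSpace B] [T2Space B] [ChartedSpace (EuclideanHalfSpace 4) B] {ι : Type} [Finite ι] {h : ι → Literature.Topology.FourManifolds.HandleAttachingMap 3 2 B} {X : Type} [TopologicalSpace X] [ChartedSpace (EuclideanHalfSpace 4) X] [IsManifold (𝓡∂ 4) ∞ X] {W : Type} [TopologicalSpace W] [ChartedSpace (EuclideanHalfSpace 4) W] [IsManifold (𝓡∂ 4) ∞ W] (D : Literature.Topology.FourManifolds.HandleAttachingMap.MultiAttachmentData h (𝓡∂ 4) X) (bX : Literature.Topology.FourManifolds.BoundaryData (𝓡∂ 4) X (𝓡 3)) (bW : Literature.Topology.FourManifolds.BoundaryData (𝓡∂ 4) W (𝓡 3)) (Ψ : bX.carrier ≃ₘ⟮𝓡 3, 𝓡 3⟯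 bW.carrier) (col : (Literature.Topology.FourManifolds.BoundaryManifold.boundaryData 3 W).Collar) (κ δ : ℝ) (hκ : 0 < κ) (hκ1 : κ ≤ 1) (hδ : 0 < δ) (hδ2 : δ ≤ 1 / 2) (j : ι) (y : ↥(Literature.Topology.FourManifolds.handleTube 3 2)) (z : bX.carrier) (a : ↥(Literature.Topology.FourManifolds.HandleAttachingMap.coresComplement h)), D.jA a = bX.incl z → (a : B) ∉ Set.range (h j).toFun → (Summit.SmoothPoincare4.SmoothPoincare4.Theorems.AcyclicBisectionExists.ModpBraidOrbits.dualMap D bX bW Ψ col κ δ hκ hκ1 hδ hδ2 j).toFun y ≠ bW.incl (Ψ z) :=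
  fun D bX bW Ψ col κ δ hκ hκ1 hδ hδ2 j y z a hz ha =>
    dualMap_apply_ne_incl D bX bW Ψ col κ δ hκ hκ1 hδ hδ2 j y z a hz ha

end Summit.SmoothPoincare4.SmoothPoincare4.Theorems.AcyclicBisectionExists.ModpBraidOrbits

end
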